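import Summits.ResolutionOfSingularities.ResolutionOfSingularities.Theorems.HomologicalConductorNoZenoTerminationLaw
import Summits.ResolutionOfSingularities.ResolutionOfSingularities.Theorems.HomologicalConductorSurfaceTerminationReduction
import Summits.ResolutionOfSingularities.ResolutionOfSingularities.Theorems.StrictDrop.Negative.StrictDropFalseOfSelfSimilarSeed
import HarnessLib

/-!
# Crux `NoZenoR` (stmt-ResolutionOfSingularities-19943) and kill test `SurfaceTermination` (stmt-16488) CANNOT BOTH FAIL —
# the vacuity bookkeeping of the W4.4 door (which side a non-terminating tower lands on)

OURS (cell res-hironaka, crux chain W4.4; lead res-L0-w44-lead-1 g12).  AI-written, weaker than expert review; nothing here is a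
statement of the manuscript under review (Hironaka 2017).  SUPPORT-level, counted 0.  Def-free; the `_of_facts` forms take the six
published surface facts of `SurfaceTermination.Reduction` BY NAME as a hypothesis, everything else is fact-free.

`NoZenoR` is an IMPLICATION `PersistenceRadical → StrictDrop → (termination along every valuation)`, and `StrictDrop` is itself a
universal statement over ALL data `(p, k, K, O, A)`.  Hence (exactly as the twin `NoZeno` stmt-16483 was closed PROVED-VACUOUS by
`not_Persistence`):

* `noZenoR_of_not_strictDrop` — `¬ StrictDrop → NoZenoR`.
* `not_strictDrop_of_nonterminating_of_isNoetherianRing` / `noZenoR_of_nonterminating_of_isNoetherianRing` — ONE admissible datum whose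
  valuation ring `O` is NOETHERIAN (a discrete valuation ring = a prime divisor, or `O = K`) and whose ca-tower has NO regular stage refutes
  `StrictDrop` (the `ℕ`-valued minimal conductor value cannot drop for ever: tree theorem
  `DiscreteDominator.terminates_of_isNoetherianRing_valuationSubring`, p597273) and therefore PROVES the crux `NoZenoR` (vacuously).
  So every K-side certificate AGAINST `NoZenoR` must run along a NON-noetherian `O` and can only land in the conditional shape
  `StrictDrop → ¬ NoZenoR` (CHAIN W4.4 §5), never as a bare `¬ NoZenoR`.
* `not_strictDrop_of_not_primeDivisorSurfaceTermination`, `noZenoR_of_not_primeDivisorSurfaceTermination`,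
  **`noZenoR_or_primeDivisorSurfaceTermination : NoZenoR ∨ PrimeDivisorSurfaceTermination`** (fact-free) — the kill test's open residue
  (the prime-divisor case (D-s), registry `genus-descent` r8) and the crux are NOT independent: a counterexample to (D-s) closes the crux
  `proved` (vacuously) and refutes `StrictDrop` (stmt-16485); conversely, as long as the crux is undecided, (D-s) cannot have been refuted.
* `noZenoR_or_surfaceTermination_of_facts (hF) : NoZenoR ∨ SurfaceTermination` and `noZenoR_of_not_surfaceTermination_of_facts` — the
  same for the kill-test item itself, modulo the six facts (tree reduction `surfaceTermination_of_strictDrop`, res-L0-w44-stub-3).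

Use (director / desk): the verdict words of the two open W4.4 items are coupled — «both refuted» is impossible; a K-side win on 16488 is
an S-side (vacuous) win on 19943 plus `refuted: StrictDrop`, after which the planners restate `StrictDrop` (e.g. to non-noetherian `O`)
exactly as `Persistence` was restated to `PersistenceRadical`.
-/

noncomputable section

-- single-problem summit: the doubled namespace component `ResolutionOfSingularities` is forced by the layout
set_option linter.dupNamespace false

namespace Summit.ResolutionOfSingularities.ResolutionOfSingularities.Theorems.NoZeno.Vacuity

open Summit.ResolutionOfSingularities.ResolutionOfSingularities.Theses.HomologicalConductor
open Summit.ResolutionOfSingularities.ResolutionOfSingularities.Theorems.NoZeno.Birth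
open Summit.ResolutionOfSingularities.ResolutionOfSingularities.Theorems
open Summit.ResolutionOfSingularities.ResolutionOfSingularities.Theorems.NoZeno
open Summit.ResolutionOfSingularities.ResolutionOfSingularities.Theorems.SurfaceTermination.Reduction

/-- **`NoZenoR` holds vacuously if `StrictDrop` fails.**  `NoZenoR` is literally `PersistenceRadical → StrictDrop → …`. [this work] -/
theorem noZenoR_of_not_strictDrop (h : ¬ StrictDrop) : NoZenoR :=
  fun _ hD => absurd hD h

/-- **A non-terminating ca-tower along a NOETHERIAN valuation ring refutes `StrictDrop`.**  If `O` is noetherian (a DVR — e.g. a prime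
divisor — or the whole field) and no stage `tower O A m` of the admissible datum `(p, k, K, O, A)` is a regular local ring, then
`StrictDrop` is false: under `StrictDrop` the tree's datum-level termination law
(`DiscreteDominator.terminates_of_isNoetherianRing_valuationSubring`) would produce a regular stage. [this work] -/
theorem not_strictDrop_of_nonterminating_of_isNoetherianRing (p : ℕ) (hp : p.Prime) (k K : Type) [Field k] [CharP k p]
    [Field K] [Algebra k K] (O : ValuationSubring K) (A : Subalgebra k K) (hk : ∀ c : k, algebraMap k K c ∈ O) (hA : A.FG)
    (hfr : IsFractionRing ↥A K) (hAO : A.toSubring ≤ O.toSubring) (hN : IsNoetherianRing ↥O)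
    (h : ∀ m : ℕ, ¬ IsRegularLocalRing ↥(tower O A m)) : ¬ StrictDrop := by
  intro hD
  obtain ⟨m, hm⟩ := DiscreteDominator.terminates_of_isNoetherianRing_valuationSubring hD p hp O A hk hA hfr hAO hN
  exact h m hm

/-- **… and therefore PROVES the crux `NoZenoR` (vacuously).**  Any K-side certificate against `NoZenoR` must run along a
NON-noetherian valuation ring. [this work] -/
theorem noZenoR_of_nonterminating_of_isNoetherianRing (p : ℕ) (hp : p.Prime) (k K : Type) [Field k] [CharP k p]
    [Field K] [Algebra k K] (O : ValuationSubring K) (A : Subalgebra k K) (hk : ∀ c : k, algebraMap k K c ∈ O) (hA : A.FG)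
    (hfr : IsFractionRing ↥A K) (hAO : A.toSubring ≤ O.toSubring) (hN : IsNoetherianRing ↥O)
    (h : ∀ m : ℕ, ¬ IsRegularLocalRing ↥(tower O A m)) : NoZenoR :=
  noZenoR_of_not_strictDrop (not_strictDrop_of_nonterminating_of_isNoetherianRing p hp k K O A hk hA hfr hAO hN h)

/-- The same with a discrete valuation ring `O` (a prime divisor is one). [this work] -/
theorem noZenoR_of_nonterminating_of_isDiscreteValuationRing (p : ℕ) (hp : p.Prime) (k K : Type) [Field k] [CharP k p]
    [Field K] [Algebra k K] (O : ValuationSubring K) (A : Subalgebra k K) (hk : ∀ c : k, algebraMap k K c ∈ O) (hA : A.FG)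
    (hfr : IsFractionRing ↥A K) (hAO : A.toSubring ≤ O.toSubring) (hdvr : IsDiscreteValuationRing ↥O)
    (h : ∀ m : ℕ, ¬ IsRegularLocalRing ↥(tower O A m)) : NoZenoR :=
  noZenoR_of_nonterminating_of_isNoetherianRing p hp k K O A hk hA hfr hAO inferInstance h

/-- **A counterexample to the kill test's prime-divisor residue refutes `StrictDrop`** (fact-free; contrapositive of the tree's
`primeDivisorSurfaceTermination_of_strictDrop`). [this work] -/
theorem not_strictDrop_of_not_primeDivisorSurfaceTermination (h : ¬ PrimeDivisorSurfaceTermination) : ¬ StrictDrop :=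
  fun hD => h (primeDivisorSurfaceTermination_of_strictDrop hD)

/-- **… and therefore proves the crux `NoZenoR` (vacuously)** (fact-free). [this work] -/
theorem noZenoR_of_not_primeDivisorSurfaceTermination (h : ¬ PrimeDivisorSurfaceTermination) : NoZenoR :=
  noZenoR_of_not_strictDrop (not_strictDrop_of_not_primeDivisorSurfaceTermination h)

/-- **The crux and the kill test's prime-divisor residue cannot both fail** (fact-free): `NoZenoR ∨ PrimeDivisorSurfaceTermination`.
[this work] -/
theorem noZenoR_or_primeDivisorSurfaceTermination : NoZenoR ∨ PrimeDivisorSurfaceTermination := by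
  by_cases hD : StrictDrop
  · exact Or.inr (primeDivisorSurfaceTermination_of_strictDrop hD)
  · exact Or.inl (noZenoR_of_not_strictDrop hD)

/-- **A counterexample to the kill test `SurfaceTermination` refutes `StrictDrop`, modulo the six published surface facts** (contrapositive
of the tree's `surfaceTermination_of_strictDrop`, res-L0-w44-stub-3). [this work] -/
theorem not_strictDrop_of_not_surfaceTermination_of_facts
    (hF : (Literature.AlgebraicGeometry.Resolution.CossartJannsenSaito2020General.{0} ∧
      Literature.AlgebraicGeometry.Resolution.Lipman1969_1_2.{0} ∧
      Literature.AlgebraicGeometry.Resolution.Lipman1969_4_1.{0} ∧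
      Literature.AlgebraicGeometry.Resolution.Lipman1969_12_1_i.{0} ∧
      Literature.AlgebraicGeometry.Resolution.Lipman1969_12_1_ii.{0} ∧
      Literature.AlgebraicGeometry.Morphisms.GortzWedhorn2023_24_44_H2.{0}))
    (h : ¬ SurfaceTermination) : ¬ StrictDrop :=
  fun hD => h (surfaceTermination_of_strictDrop hF hD)

/-- **… and therefore proves the crux `NoZenoR`**, modulo the six facts. [this work] -/
theorem noZenoR_of_not_surfaceTermination_of_facts
    (hF : (Literature.AlgebraicGeometry.Resolution.CossartJannsenSaito2020General.{0} ∧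
      Literature.AlgebraicGeometry.Resolution.Lipman1969_1_2.{0} ∧
      Literature.AlgebraicGeometry.Resolution.Lipman1969_4_1.{0} ∧
      Literature.AlgebraicGeometry.Resolution.Lipman1969_12_1_i.{0} ∧
      Literature.AlgebraicGeometry.Resolution.Lipman1969_12_1_ii.{0} ∧
      Literature.AlgebraicGeometry.Morphisms.GortzWedhorn2023_24_44_H2.{0}))
    (h : ¬ SurfaceTermination) : NoZenoR :=
  noZenoR_of_not_strictDrop (not_strictDrop_of_not_surfaceTermination_of_facts hF h)

/-- **`NoZenoR ∨ SurfaceTermination`, modulo the six facts**: the two open items of route `HomologicalConductor`'s W4.4 door are logically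
coupled — «both refuted» is impossible. [this work] -/
theorem noZenoR_or_surfaceTermination_of_facts
    (hF : (Literature.AlgebraicGeometry.Resolution.CossartJannsenSaito2020General.{0} ∧
      Literature.AlgebraicGeometry.Resolution.Lipman1969_1_2.{0} ∧
      Literature.AlgebraicGeometry.Resolution.Lipman1969_4_1.{0} ∧
      Literature.AlgebraicGeometry.Resolution.Lipman1969_12_1_i.{0} ∧
      Literature.AlgebraicGeometry.Resolution.Lipman1969_12_1_ii.{0} ∧
      Literature.AlgebraicGeometry.Morphisms.GortzWedhorn2023_24_44_H2.{0})) :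
    NoZenoR ∨ SurfaceTermination := by
  by_cases hD : StrictDrop
  · exact Or.inr (surfaceTermination_of_strictDrop hF hD)
  · exact Or.inl (noZenoR_of_not_strictDrop hD)

/-! ## Appended (rev 2, lead g12): the self-similar seed of the negative catalogue PROVES the crux

`Theorems/StrictDrop/Negative/StrictDropFalseOfSelfSimilarSeed.lean` (tree) shows
`SelfSimilarSeed → ¬ StrictDrop`: a stage `T_s` that is singular with `T_(s+1) = σ(T_s)` for a `k`-automorphism
`σ` of `K` preserving `O` and NOT DECREASING values (`σ z · z⁻¹ ∈ O`) keeps the minimal conductor value from ever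
dropping.  By `noZenoR_of_not_strictDrop` such a seed therefore PROVES `NoZenoR` (vacuously).  (The crux docstring's
feared «Hénon-type eigenvaluation γ ↦ γ/p» tower has value-DECREASING `σ` and is NOT a `SelfSimilarSeed`; it would
live in the conditional shape `StrictDrop → ¬ NoZenoR` of CHAIN §5.) -/

/-- **A self-similar seed (value-non-decreasing self-similar tower) proves `NoZenoR`** — because it refutes the
binder `StrictDrop` (`StrictDrop_false_of_SelfSimilarSeed`, tree). [this work] -/
theorem noZenoR_of_selfSimilarSeed (h : StrictDrop.Negative.SelfSimilar.SelfSimilarSeed) : NoZenoR :=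
  noZenoR_of_not_strictDrop (StrictDrop.Negative.SelfSimilar.StrictDrop_false_of_SelfSimilarSeed h)

end Summit.ResolutionOfSingularities.ResolutionOfSingularities.Theorems.NoZeno.Vacuity

end
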